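import Summits.NavierStokesRegularity.NavierStokesRegularity.Theorems.EfficiencyFloorMaximiserSetRigidityProfileEnstrophyBalance
import Literature.Analysis.FluidPDE.TsaiSelfSimilarHolds
import HarnessLib

/-!
# Route `EfficiencyFloor`, crux `MaximiserSetRigidity` (stmt-NavierStokesRegularity-25512), part (b):
# NO NON-ROTATING RELATIVE EQUILIBRIUM is a normalised maximiser — UNCONDITIONAL

Helper file (`--supports stmt-NavierStokesRegularity-25512`). Sequel to `…ProfileEnstrophyBalance` ((EB) proved;
`rate_pos_of_profile`: a normalised maximiser can solve the relative-equilibrium profile equation only with a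
collapsing rate `c′ > 0`). For the NON-ROTATING, NON-DRIFTING sub-family of the item's (b)-clause (`W = 0`,
`a = 0`: steady states and self-similarly collapsing / expanding profiles `νΔm − (m·∇)m − ∇π = c′(m + (x·∇)m)`)
the remaining Liouville input (L⁺) IS the tree's PROVED Tsai theorem
(`Literature.Analysis.FluidPDE.tsai_selfsimilar_holds`, Tsai 1998 Thm. 1: a `C²` Leray profile in `L^q`,
`3 < q < ∞`, vanishes): an admissible `m` (`D⁰m, D¹m ∈ L²`) is in `L⁶` by the Sobolev embedding `H¹ ⊂ L⁶`, and
the profile equation with `c′ > 0` is Leray's profile system `IsLerayProfile ν c′ m π` verbatim.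

* `memLp_six` — admissible fields are in `L⁶(ℝ³)`;
* `isLerayProfile_of_eq` — the item's profile equation at `a = 0`, `W = 0` is `IsLerayProfile ν c′ m π`;
* `collapseLiouville_noRotation_noDrift` — (L⁺) at `a = 0`, `W = 0`: no admissible `m` with `Z(m) > 0` solves it
  with `c′ > 0` (Tsai);
* `partB_noRotation_noDrift` — for `c, ν > 0` and every `m` satisfying the item's normalised-maximiser clause
  verbatim: for all smooth `π` and all `c′ ∈ ℝ`, `¬ (νΔm − (m·∇)m − ∇π = c′(m + (x·∇)m))` (the (b)-clause at
  `a = 0`, `W = 0`, stated with the item's own right-hand side `Dm·0 + (Dm(0x) − 0(m)) + c′(m + (x·∇)m)`).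
  UNCONDITIONAL: `c′ ≤ 0` by `rate_pos_of_profile`, `c′ > 0` by Tsai.

So of the item's part (b) only the ROTATING relative equilibria (`W ≠ 0`; drift `a` is removable by a translation
when `c′ ≠ 0`, not done here) remain, and for them (b) ⟸ (L⁺) (`partB_of_collapseLiouville`). HONEST FRAMING:
part (a) of stmt-25512, the rotating case of (b), `RigidExit`, `LerayFloorGap`, `ProductionEfficiencyDecay` and
Navier–Stokes regularity stay OPEN; no summit statement is proved. References: Tsai 1998 (ARMA 143) Thm. 1;
Nečas–Růžička–Šverák 1996 Thm. 1; Evans 2010 §5.6.1 (Sobolev). [folklore]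
-/

noncomputable section

-- the problem directory repeats the summit name (`NavierStokesRegularity/NavierStokesRegularity`)
set_option linter.dupNamespace false

namespace Summit.NavierStokesRegularity.NavierStokesRegularity.Theorems

namespace MaximiserSetRigidity

namespace ProfileLiouville

open MeasureTheory Set Filter Topology Module InnerProductSpace
open scoped RealInnerProductSpace Laplacian ContDiff ENNReal
open Literature.Analysis Literature.Analysis.FluidPDE
open Summit.NavierStokesRegularity.NavierStokesRegularity.Theorems.Magsanop2026Enstrophy (slice_integrable)

/-- **Admissible fields are in `L⁶(ℝ³)`**: `m` smooth with `D⁰m, D¹m, D²m ∈ L²` has `m ∈ L⁶` (Sobolev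
`H¹ ⊂ L⁶`, Mathlib's Gagliardo–Nirenberg–Sobolev inequality in the tree's whole-space form). [folklore] -/
theorem memLp_six {m : (EuclideanSpace ℝ (Fin 3)) → (EuclideanSpace ℝ (Fin 3))} (hm : ContDiff ℝ ∞ m)
    (h0 : ∫⁻ x, ‖iteratedFDeriv ℝ 0 m x‖ₑ ^ 2 < ⊤) (h1 : ∫⁻ x, ‖iteratedFDeriv ℝ 1 m x‖ₑ ^ 2 < ⊤)
    (h2 : ∫⁻ x, ‖iteratedFDeriv ℝ 2 m x‖ₑ ^ 2 < ⊤) :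
    MemLp m 6 (volume : Measure (EuclideanSpace ℝ (Fin 3))) := by
  have hm3 : ContDiff ℝ 3 m := contDiff_infty.1 hm 3
  have hm1 : ContDiff ℝ 1 m := contDiff_infty.1 hm 1
  have hmc : Continuous m := hm.continuous
  have hDmc : Continuous (fderiv ℝ m) := hm.continuous_fderiv (by simp)
  have Im2 : Integrable (fun x => ‖m x‖ ^ 2) := by
    have h0' : ∫⁻ x, ‖m x‖ₑ ^ 2 < ⊤ := by
      refine lt_of_le_of_lt (le_of_eq (lintegral_congr fun x => ?_)) h0
      rw [← ofReal_norm, ← norm_iteratedFDeriv_zero (𝕜 := ℝ) (f := m), ofReal_norm]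
    exact integrable_sq_norm_of_lintegral_lt_top hmc h0'
  obtain ⟨-, -, -, -, -, IDv, -⟩ := slice_integrable hm3 h1 h2
  have m2 : MemLp m 2 volume := (memLp_two_iff_integrable_sq_norm hmc.aestronglyMeasurable).2 Im2
  have mD : MemLp (fderiv ℝ m) 2 volume :=
    (memLp_two_iff_integrable_sq_norm hDmc.aestronglyMeasurable).2 IDv
  have hsob := eLpNorm_six_le_eLpNorm_fderiv_two (volume : Measure (EuclideanSpace ℝ (Fin 3)))
    finrank_euclideanSpace_fin hm1 m2.eLpNorm_lt_top
  exact ⟨hmc.aestronglyMeasurable,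
    lt_of_le_of_lt hsob (ENNReal.mul_lt_top ENNReal.coe_lt_top mD.eLpNorm_lt_top)⟩

/-- **The non-rotating, non-drifting profile equation is Leray's profile system.** If `m ∈ C²` is divergence
free, `π ∈ C¹` and `νΔm − (m·∇)m − ∇π = Dm·0 + (Dm(0x) − 0(m x)) + c′(m + (x·∇)m)` pointwise (the item's
relative-equilibrium equation at `a = 0`, `W = 0`), then `(m, π)` is a Leray profile with rate `c′`:
`−νΔm + c′m + c′(x·∇)m + (m·∇)m + ∇π = 0`. [folklore] -/
theorem isLerayProfile_of_eq {ν c' : ℝ} {m : (EuclideanSpace ℝ (Fin 3)) → (EuclideanSpace ℝ (Fin 3))}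
    {π : (EuclideanSpace ℝ (Fin 3)) → ℝ} (hm : ContDiff ℝ 2 m) (hdiv : VectorCalculus.IsDivFree m)
    (hπ : ContDiff ℝ 1 π)
    (heq : ∀ x : EuclideanSpace ℝ (Fin 3), ν • Δ m x - convect m m x - gradient π x =
      fderiv ℝ m x 0 + (fderiv ℝ m x ((0 : (EuclideanSpace ℝ (Fin 3)) →L[ℝ] (EuclideanSpace ℝ (Fin 3))) x) -
        (0 : (EuclideanSpace ℝ (Fin 3)) →L[ℝ] (EuclideanSpace ℝ (Fin 3))) (m x)) + c' • (m x + fderiv ℝ m x x)) :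
    IsLerayProfile ν c' m π where
  contDiff_velocity := hm
  contDiff_pressure := hπ
  profile_eq y := by
    have h := heq y
    simp only [map_zero, zero_apply, sub_zero, zero_add, smul_add] at h
    have e : -(ν • (Δ m) y) + c' • m y + c' • fderiv ℝ m y y + convect m m y + gradient π y =
        -(ν • Δ m y - convect m m y - gradient π y - (c' • m y + c' • fderiv ℝ m y y)) := by abel
    rw [e, h, sub_self, neg_zero]
  divFree := hdiv

/-- **(L⁺) for non-rotating, non-drifting profiles (Tsai 1998).** No smooth divergence-free `m` with
`D⁰m, D¹m, D²m ∈ L²` and `Z(m) = ∫|curl m|² > 0` solves `νΔm − (m·∇)m − ∇π = c′(m + (x·∇)m)` (`π` smooth)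
with a collapsing rate `c′ > 0`, `ν > 0`: `m ∈ L⁶` (`memLp_six`) is a Leray profile (`isLerayProfile_of_eq`),
hence `m = 0` by `tsai_selfsimilar_holds`, contradicting `Z(m) > 0`. [cite: Tsai1998, Thm 1] -/
theorem collapseLiouville_noRotation_noDrift (ν : ℝ) (hν : 0 < ν)
    (m : (EuclideanSpace ℝ (Fin 3)) → (EuclideanSpace ℝ (Fin 3))) (π : (EuclideanSpace ℝ (Fin 3)) → ℝ) (c' : ℝ)
    (hadm : ContDiff ℝ (⊤ : ℕ∞) m ∧ Literature.Analysis.FluidPDE.VectorCalculus.IsDivFree m ∧ (∫⁻ x,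
      ‖iteratedFDeriv ℝ 0 m x‖ₑ ^ 2 < ⊤) ∧ (∫⁻ x, ‖iteratedFDeriv ℝ 1 m x‖ₑ ^ 2 < ⊤) ∧ (∫⁻ x, ‖iteratedFDeriv
      ℝ 2 m x‖ₑ ^ 2 < ⊤))
    (hZ : 0 < (∫ x, ‖Literature.Analysis.FluidPDE.curl m x‖ ^ 2)) (hπ : ContDiff ℝ (⊤ : ℕ∞) π)
    (hc' : 0 < c') :
    ¬ (∀ x : EuclideanSpace ℝ (Fin 3), ν • Laplacian.laplacian m x - Literature.Analysis.FluidPDE.convect m m x -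
      gradient π x = fderiv ℝ m x 0 +
        (fderiv ℝ m x ((0 : (EuclideanSpace ℝ (Fin 3)) →L[ℝ] (EuclideanSpace ℝ (Fin 3))) x) -
          (0 : (EuclideanSpace ℝ (Fin 3)) →L[ℝ] (EuclideanSpace ℝ (Fin 3))) (m x)) + c' • (m x + fderiv ℝ m x x)) := by
  intro heq
  obtain ⟨hm, hdiv, h0, h1, h2⟩ := hadm
  have hprof : IsLerayProfile ν c' m π :=
    isLerayProfile_of_eq (contDiff_infty.1 hm 2) hdiv (contDiff_infty.1 hπ 1) heq
  have m6 := memLp_six hm h0 h1 h2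
  have hzero : m = 0 :=
    tsai_selfsimilar_holds hν hc' hprof (q := 6) (by norm_num) (by simp) m6
  have hcurl : ∀ x, curl m x = 0 := fun x => by rw [hzero]; exact curl_zero x
  have : (∫ x, ‖Literature.Analysis.FluidPDE.curl m x‖ ^ 2) = 0 := by
    simp [hcurl]
  exact absurd this (ne_of_gt hZ)

/-- **Part (b) of `MaximiserSetRigidity` at `a = 0`, `W = 0` — UNCONDITIONAL.** For `c, ν > 0` and every `m`
satisfying the item's normalised-maximiser clause verbatim, NO steady or self-similarly collapsing / expanding
profile equation `νΔm − (m·∇)m − ∇π = c′(m + (x·∇)m)` holds (`π` smooth, `c′ ∈ ℝ`): the enstrophy balance (EB)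
forces `c′ = (27c⁴/(128ν³))Z(m)² > 0` (`ProfileEnstrophyBalance.rate_pos_of_profile`), and the collapsing case
is excluded by Tsai's Liouville theorem (`collapseLiouville_noRotation_noDrift`). The right-hand side is written
exactly as the item's (b)-clause instantiated at `a = 0`, `W = 0`. HONEST FRAMING: the rotating relative
equilibria (`W ≠ 0`) of part (b) and all of part (a) remain open. [folklore] -/
theorem partB_noRotation_noDrift (c ν : ℝ) (hc : 0 < c) (hν : 0 < ν)
    (m : (EuclideanSpace ℝ (Fin 3)) → (EuclideanSpace ℝ (Fin 3)))
    (hm : ((ContDiff ℝ (⊤ : ℕ∞) m ∧ Literature.Analysis.FluidPDE.VectorCalculus.IsDivFree m ∧ (∫⁻ x, ‖iteratedFDeriv ℝ 0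
      m x‖ₑ ^ 2 < ⊤) ∧ (∫⁻ x, ‖iteratedFDeriv ℝ 1 m x‖ₑ ^ 2 < ⊤) ∧ (∫⁻ x, ‖iteratedFDeriv ℝ 2 m x‖ₑ ^ 2 < ⊤))
      ∧ 0 < (∫ x, ‖Literature.Analysis.FluidPDE.curl m x‖ ^ 2) ∧ (∫ x, ⟪Literature.Analysis.FluidPDE.curl m x,
      fderiv ℝ m x (Literature.Analysis.FluidPDE.curl m x)⟫_ℝ) = c * (∫ x, ‖Literature.Analysis.FluidPDE.curl
      m x‖ ^ 2) ^ (3 / 4 : ℝ) * (∫ x, Literature.Analysis.FluidPDE.frobeniusNormSq (fderiv ℝ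
      (Literature.Analysis.FluidPDE.curl m) x)) ^ (3 / 4 : ℝ) ∧ (∫ x,
      Literature.Analysis.FluidPDE.frobeniusNormSq (fderiv ℝ (Literature.Analysis.FluidPDE.curl m) x)) = 81 *
      c ^ 4 / (256 * ν ^ 4) * (∫ x, ‖Literature.Analysis.FluidPDE.curl m x‖ ^ 2) ^ 3)) :
    ∀ (π : (EuclideanSpace ℝ (Fin 3)) → ℝ) (c' : ℝ), ContDiff ℝ (⊤ : ℕ∞) π →
      ¬ (∀ x : EuclideanSpace ℝ (Fin 3), ν • Laplacian.laplacian m x - Literature.Analysis.FluidPDE.convect m m x -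
        gradient π x = fderiv ℝ m x 0 +
          (fderiv ℝ m x ((0 : (EuclideanSpace ℝ (Fin 3)) →L[ℝ] (EuclideanSpace ℝ (Fin 3))) x) -
            (0 : (EuclideanSpace ℝ (Fin 3)) →L[ℝ] (EuclideanSpace ℝ (Fin 3))) (m x)) + c' • (m x + fderiv ℝ m x x)) := by
  intro π c' hπ heq
  have hW : ∀ x y : EuclideanSpace ℝ (Fin 3),
      ⟪(0 : (EuclideanSpace ℝ (Fin 3)) →L[ℝ] (EuclideanSpace ℝ (Fin 3))) x, y⟫_ℝ =
        -⟪x, (0 : (EuclideanSpace ℝ (Fin 3)) →L[ℝ] (EuclideanSpace ℝ (Fin 3))) y⟫_ℝ := fun x y => by simp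
  have hc' : 0 < c' := ProfileEnstrophyBalance.rate_pos_of_profile c ν hc hν m hm hπ hW heq
  exact collapseLiouville_noRotation_noDrift ν hν m π c' hm.1 hm.2.1 hπ hc' heq

end ProfileLiouville

end MaximiserSetRigidity

end Summit.NavierStokesRegularity.NavierStokesRegularity.Theorems

end
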